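import Literature.Geometry.Lorentzian.IsometricImmersionRigidity
import Literature.Geometry.Lorentzian.CauchyDevelopmentOneJet
import Literature.Geometry.Lorentzian.CauchyDevelopmentIsometryClasses
import HarnessLib

/-!
# Uniqueness of the maximal globally hyperbolic vacuum development
# (Choquet-Bruhat–Geroch 1969, Thm. 3, uniqueness clause) — unconditional

`CauchyProblemCauchy` proves that two maximal vacuum Cauchy developments of the same data are
isometric *given rigidity* of the first (`VacuumCauchyDevelopment.isIsometricTo_of_isMaximal`,
hypothesis `hrig`), and `CauchyDevelopmentOneJet` reduces `hrig` to O'Neill's one-jet rigidity of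
local isometries of the first spacetime (hypothesis `hjet`: an isometric immersion `M → M`
fixing a point to first order is the identity; O'Neill 1983, Ch. 3, Prop. 3.62 = Sbierski 2016,
§3.1, first lemma). `IsometricImmersionRigidity` proves that lemma
(`PseudoRiemannianMetric.IsIsometricImmersion.eq_of_mfderiv_eq`, by an ODE argument in charts).
This file discharges `hjet` and records the resulting **unconditional** theorems:

* `Spacetime.eq_id_of_isIsometricImmersion` — one-jet rigidity of every spacetime (`hjet`);
* `DataEmbedding.eq_id_of_comp_embed_eq'` — a time-orientation preserving isometric immersion
  of a data embedding into itself commuting with the embedding of the data is the identity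
  (the hypothesis `hrig` of `CauchyProblemCauchy`, discharged);
* `DataEmbedding.isIsometricTo_of_embedsInto'` — data embeddings which embed into each other are
  isometric;
* `VacuumCauchyDevelopment.isIsometricTo_of_isMaximal'` and `mghd_unique_cauchy` — **any two
  maximal vacuum Cauchy developments of the same initial data set are isometric as developments**
  (Choquet-Bruhat–Geroch, Comm. Math. Phys. 14 (1969), Thm. 3, p. 332: "This development is unique
  (up to isometry)"; Ringström 2009, Thm. 16.6; Sbierski 2016, Thm. 2.8): the corrected form of the
  named fact `mghd_unique` of `CauchyProblem` (module docstring of `CauchyProblemCauchy`: "the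
  corrected named fact itself … is deliberately not declared here … its proof needs the rigidity
  step"), now a theorem;
* `VacuumCauchyDevelopment.IsMaximal.isIsometricTo_of_embedsInto'` — the MGHD is inextendible
  among vacuum Cauchy developments;
* `DataEmbedding.eq_of_comp_embed_eq` — the embedding of one development into another is unique
  (Sbierski 2016, §3.1, corollary to the first lemma; Choquet-Bruhat–Geroch 1969, p. 333, "By
  uniqueness, `ψ_αγ = ψ_βγ ψ_αβ`"), the coherence needed to glue developments;
* § Restored interface: `DataEmbedding.oneJet_rigid`, `…isIsometricTo_of_embedsInto_embedsInto`,
  `…isIsometricTo_iff_embedsInto_and_embedsInto`, `VacuumCauchyDevelopment.isIsometricTo_of_isMaximal_isMaximal`,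
  `…IsMaximal.isMaximal_iff_isIsometricTo`, `choquetBruhat_geroch_exists_mghd_cauchy.existsUnique_upTo_isIsometricTo`
  (the declarations of the superseded first version of this file, restored under their names).

This is the uniqueness half of the theorem whose existence half is the named fact
`choquetBruhat_geroch_exists_mghd_cauchy` (`CauchyProblemMGHDExistence`).

## References

* Y. Choquet-Bruhat, R. Geroch, *Global aspects of the Cauchy problem in general relativity*,
  Comm. Math. Phys. 14 (1969) 329–335, Thm. 3 and its proof (pp. 332–334).
* J. Sbierski, Ann. Henri Poincaré 17 (2016) 301–329 = arXiv:1309.7591, §3.1, Thm. 2.8.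
* H. Ringström, *The Cauchy Problem in General Relativity*, EMS 2009, Thm. 16.6.
* B. O'Neill, *Semi-Riemannian geometry with applications to relativity*, 1983, Ch. 3, Prop. 3.62.
-/

noncomputable section

open Function Set Module
open scoped Manifold ContDiff Topology

namespace Literature.Geometry.Lorentzian

universe u

/-! ### One-jet rigidity of spacetimes -/

/-- **One-jet rigidity of local isometries of a spacetime** (O'Neill 1983, Ch. 3, Prop. 3.62;
Sbierski 2016, §3.1, first lemma): an isometric immersion `φ : M → M` of the (connected,
Hausdorff, `(d)`-dimensional, `C^∞`) spacetime `𝓢` into itself which fixes a point `p` with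
`dφ_p = id` is the identity map — `PseudoRiemannianMetric.IsIsometricImmersion.eq_of_mfderiv_eq`
applied to `φ` and `id`. This is the hypothesis `hjet` of `CauchyDevelopmentOneJet`.
[cite: ONeillSemiRiemannian1983, Ch. 3, Prop. 3.62] -/
theorem Spacetime.eq_id_of_isIsometricImmersion {d : ℕ} (𝓢 : Spacetime.{u} d)
    {φ : 𝓢.carrier → 𝓢.carrier}
    (hφ : 𝓢.metric.IsIsometricImmersion 𝓢.metric.toPseudoRiemannianMetric φ) {p : 𝓢.carrier}
    (hp : φ p = p)
    (hd : ∀ w : TangentSpace (𝓡 d) p, mfderiv (𝓡 d) (𝓡 d) φ p w = w) : φ = id := by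
  have hid : 𝓢.metric.IsIsometricImmersion 𝓢.metric.toPseudoRiemannianMetric id :=
    ⟨contMDiff_id, fun y ↦ by rw [pullbackBilin_id]⟩
  refine hφ.eq_of_mfderiv_eq (p := p) (WithTop.coe_le_coe.mpr le_top) rfl hid hp ?_
  rw [mfderiv_id]
  ext w
  exact hd w

section Developments

variable {n : ℕ} {X' : Type u} [TopologicalSpace X'] [ChartedSpace (EuclideanSpace ℝ (Fin n)) X']
  [IsManifold (𝓡 n) ∞ X'] [ConnectedSpace X'] {D : InitialDataSet (𝓡 n) X'}

namespace DataEmbedding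

/-- **Rigidity of data embeddings** (the hypothesis `hrig` of `CauchyProblemCauchy`,
discharged): a time-orientation preserving isometric immersion `φ : M → M` of a data embedding
into itself with `φ ∘ ι = ι` is the identity — its one-jet is the identity along `ι(X)`
(`mfderiv_apply_eq_self_of_comp_embed_eq`, Sbierski 2016, §3.1, corollary), and one-jet
rigidity holds (`Spacetime.eq_id_of_isIsometricImmersion`). Choquet-Bruhat–Geroch 1969, proof of
Thm. 3, p. 332 ("ψ and ψ̃ coincide wherever they are both defined").
[cite: ChoquetBruhatGeroch1969CMP, Thm. 3, proof (p. 332)] -/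
theorem eq_id_of_comp_embed_eq' (𝒮 : DataEmbedding D) {φ : 𝒮.carrier → 𝒮.carrier}
    (hφi : 𝒮.metric.IsIsometricImmersion 𝒮.metric.toPseudoRiemannianMetric φ)
    (hφτ : 𝒮.timeOrientation.PreservesTimeOrientation φ 𝒮.timeOrientation)
    (hφι : φ ∘ 𝒮.embed = 𝒮.embed) : φ = id :=
  𝒮.eq_id_of_comp_embed_eq
    (fun _ hφ _ hp hd ↦ 𝒮.toSpacetime.eq_id_of_isIsometricImmersion hφ hp hd) hφi hφτ hφι

/-- **Mutual embeddings of data embeddings are isometries** (`isIsometricTo_of_embedsInto` with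
its rigidity hypothesis discharged). Choquet-Bruhat–Geroch 1969, p. 334 ("The uniqueness of M
follows immediately from the uniqueness of (U, ψ)"). [cite: ChoquetBruhatGeroch1969CMP, Thm. 3, proof (p. 334)] -/
theorem isIsometricTo_of_embedsInto' {𝒮₁ 𝒮₂ : DataEmbedding D} (h₁₂ : 𝒮₁.EmbedsInto 𝒮₂)
    (h₂₁ : 𝒮₂.EmbedsInto 𝒮₁) : 𝒮₁.IsIsometricTo 𝒮₂ :=
  isIsometricTo_of_embedsInto (fun _ hφi hφτ hφι ↦ 𝒮₁.eq_id_of_comp_embed_eq' hφi hφτ hφι) h₁₂ h₂₁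

end DataEmbedding

/-- **Uniqueness of the maximal globally hyperbolic vacuum development** (Choquet-Bruhat–Geroch,
Comm. Math. Phys. 14 (1969), Thm. 3, p. 332: "This development is unique (up to isometry)";
Ringström 2009, Thm. 16.6; Sbierski 2016, Thm. 2.8: "The GHD M̃ is unique up to isometry"). Any two
maximal vacuum Cauchy developments `𝒟₁, 𝒟₂` of the same initial data set on a connected manifold
(`VacuumCauchyDevelopment.IsMaximal`: every vacuum Cauchy development of the data embeds into
them, `CauchyDevelopment.lean`) are isometric as developments: a time-orientation preserving
isometric diffeomorphism commuting with the embeddings of the data manifold. Proof: each embeds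
into the other by maximality; the composite self-embedding of `𝒟₁` fixes `ι₁(X)`, so it has
identity one-jet there and is the identity by one-jet rigidity; hence the embeddings are mutually
inverse (`DataEmbedding.isIsometricTo_of_embedsInto'`). Unconditional form of
`VacuumCauchyDevelopment.isIsometricTo_of_isMaximal` (`CauchyProblemCauchy`) and
`…_of_oneJet` (`CauchyDevelopmentOneJet`). [cite: ChoquetBruhatGeroch1969CMP, Thm. 3 (pp. 332–334)] -/
theorem VacuumCauchyDevelopment.isIsometricTo_of_isMaximal' {𝒟₁ 𝒟₂ : VacuumCauchyDevelopment D}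
    (h₁ : 𝒟₁.IsMaximal) (h₂ : 𝒟₂.IsMaximal) :
    𝒟₁.toCauchyDevelopment.IsIsometricTo 𝒟₂.toCauchyDevelopment :=
  DataEmbedding.isIsometricTo_of_embedsInto' (h₂ 𝒟₁) (h₁ 𝒟₂)

/-- **An extension of a maximal vacuum Cauchy development is isometric to it**: the MGHD is
inextendible among the vacuum Cauchy developments of its data (an extension of a maximal
development is maximal, since embeddings compose). Choquet-Bruhat–Geroch 1969, Thm. 3; Sbierski
2016, end of §3.3. [cite: ChoquetBruhatGeroch1969CMP, Thm. 3 (pp. 332–334)] -/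
theorem VacuumCauchyDevelopment.IsMaximal.isIsometricTo_of_embedsInto'
    {𝒟₁ 𝒟₂ : VacuumCauchyDevelopment D} (h₁ : 𝒟₁.IsMaximal)
    (h₁₂ : 𝒟₁.toCauchyDevelopment.EmbedsInto 𝒟₂.toCauchyDevelopment) :
    𝒟₁.toCauchyDevelopment.IsIsometricTo 𝒟₂.toCauchyDevelopment :=
  isIsometricTo_of_isMaximal' h₁ fun 𝒟 ↦ (h₁ 𝒟).trans h₁₂

/-- **gr.S12, uniqueness clause, corrected and proved** — the statement recorded in the module
docstring of `CauchyProblemCauchy` as the corrected form of the named fact `mghd_unique`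
(`CauchyProblem`, over the uninhabited `VacuumDevelopment`), i.e. `mghd_unique` verbatim with
`VacuumDevelopment ↦ VacuumCauchyDevelopment`, in every dimension `n + 1`: any two maximal vacuum
Cauchy developments of a smooth initial data set on a connected `n`-manifold are isometric as
developments. Choquet-Bruhat–Geroch 1969, Thm. 3 (p. 332); Ringström 2009, Thm. 16.6; Sbierski
2016, Thm. 2.8. [cite: Ringstrom2009, Thm. 16.6] -/
theorem mghd_unique_cauchy (𝒟₁ 𝒟₂ : VacuumCauchyDevelopment D) (h₁ : 𝒟₁.IsMaximal)
    (h₂ : 𝒟₂.IsMaximal) : 𝒟₁.toCauchyDevelopment.IsIsometricTo 𝒟₂.toCauchyDevelopment :=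
  VacuumCauchyDevelopment.isIsometricTo_of_isMaximal' h₁ h₂

end Developments

/-! ### Uniqueness of the embedding of one development into another -/

section EmbeddingUnique

variable {n : ℕ} {X' : Type u} [TopologicalSpace X'] [ChartedSpace (EuclideanSpace ℝ (Fin n)) X']
  [IsManifold (𝓡 n) ∞ X'] [ConnectedSpace X'] {D : InitialDataSet (𝓡 n) X'}

/-- **The embedding of one development into another is unique** (Sbierski 2016, §3.1, corollary
to the first lemma, in the global form `U₁ = U₂ = M₁`; Choquet-Bruhat–Geroch 1969, proof of
Thm. 3, p. 332: "ψ and ψ̃ coincide wherever they are both defined", whence "By uniqueness,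
`ψ_αγ = ψ_βγ ψ_αβ`", p. 333): two time-orientation preserving isometric immersions
`ψ, ψ' : M₁ → M₂` of data embeddings of the same data with `ψ ∘ ι₁ = ι₂ = ψ' ∘ ι₁` are equal —
they agree to first order along `ι₁(X)` (`DataEmbedding.mfderiv_eq_mfderiv_of_comp_embed_eq`,
`CauchyDevelopmentOneJet`) and `M₁` is connected
(`PseudoRiemannianMetric.IsIsometricImmersion.eq_of_mfderiv_eq`). In particular the witnesses of
`DataEmbedding.EmbedsInto` / `CauchyDevelopment.EmbedsInto` are unique, and embeddings of
developments compose coherently. [cite: Sbierski2016AHP, §3.1, corollary to the first lemma] -/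
theorem DataEmbedding.eq_of_comp_embed_eq (𝒮₁ 𝒮₂ : DataEmbedding D)
    {ψ ψ' : 𝒮₁.carrier → 𝒮₂.carrier}
    (hψi : 𝒮₁.metric.IsIsometricImmersion 𝒮₂.metric.toPseudoRiemannianMetric ψ)
    (hψτ : 𝒮₁.timeOrientation.PreservesTimeOrientation ψ 𝒮₂.timeOrientation)
    (hψι : ψ ∘ 𝒮₁.embed = 𝒮₂.embed)
    (hψ'i : 𝒮₁.metric.IsIsometricImmersion 𝒮₂.metric.toPseudoRiemannianMetric ψ')
    (hψ'τ : 𝒮₁.timeOrientation.PreservesTimeOrientation ψ' 𝒮₂.timeOrientation)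
    (hψ'ι : ψ' ∘ 𝒮₁.embed = 𝒮₂.embed) : ψ = ψ' := by
  obtain ⟨x⟩ : Nonempty X' := inferInstance
  have hp : ψ (𝒮₁.embed x) = ψ' (𝒮₁.embed x) := by
    rw [← comp_apply (f := ψ), hψι, ← comp_apply (f := ψ'), hψ'ι]
  refine hψi.eq_of_mfderiv_eq (p := 𝒮₁.embed x) (WithTop.coe_le_coe.mpr le_top) rfl hψ'i hp ?_
  ext w
  exact 𝒮₁.mfderiv_eq_mfderiv_of_comp_embed_eq 𝒮₂ hψi hψτ hψι hψ'i hψ'τ hψ'ι x w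

end EmbeddingUnique

/-! ### Restored interface (declarations of the superseded version of this file)

The first landing of `MGHDUniqueness.lean` (another seat) declared the results below; the second
landing (this file) replaced that file wholesale. They are restored here as one-line consequences
of the theorems above and of `CauchyDevelopmentIsometryClasses` (`IsIsometricTo.symm`,
`IsIsometricTo.embedsInto`), under the original names. -/

section Restored

variable {n : ℕ} {X' : Type u} [TopologicalSpace X'] [ChartedSpace (EuclideanSpace ℝ (Fin n)) X']
  [IsManifold (𝓡 n) ∞ X'] [ConnectedSpace X'] {D : InitialDataSet (𝓡 n) X'}

/-- **One-jet rigidity of the spacetime of a data embedding** (`Spacetime.eq_id_of_isIsometricImmersion`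
for `𝒮.toSpacetime`): an isometric immersion `M → M` fixing a point to first order is the
identity. O'Neill 1983, Ch. 3, Prop. 3.62. [cite: ONeillSemiRiemannian1983, Ch. 3, Prop. 3.62] -/
theorem DataEmbedding.oneJet_rigid (𝒮 : DataEmbedding D) {φ : 𝒮.carrier → 𝒮.carrier}
    (hφ : 𝒮.metric.IsIsometricImmersion 𝒮.metric.toPseudoRiemannianMetric φ) {p : 𝒮.carrier}
    (hp : φ p = p)
    (hd : ∀ w : TangentSpace (𝓡 (n + 1)) p, mfderiv (𝓡 (n + 1)) (𝓡 (n + 1)) φ p w = w) :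
    φ = id :=
  𝒮.toSpacetime.eq_id_of_isIsometricImmersion hφ hp hd

/-- Data embeddings which embed into each other are isometric (`isIsometricTo_of_embedsInto'`).
Choquet-Bruhat–Geroch 1969, p. 334. [cite: ChoquetBruhatGeroch1969CMP, Thm. 3, proof (p. 334)] -/
theorem DataEmbedding.isIsometricTo_of_embedsInto_embedsInto {𝒮₁ 𝒮₂ : DataEmbedding D}
    (h₁₂ : 𝒮₁.EmbedsInto 𝒮₂) (h₂₁ : 𝒮₂.EmbedsInto 𝒮₁) : 𝒮₁.IsIsometricTo 𝒮₂ :=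
  DataEmbedding.isIsometricTo_of_embedsInto' h₁₂ h₂₁

/-- **Two data embeddings are isometric iff they embed into each other** (`→`: an isometry and
its inverse are embeddings, `IsIsometricTo.embedsInto`, `IsIsometricTo.symm`; `←`: rigidity).
Sbierski 2016, §2 (Remark after the definition of a CGHD); Choquet-Bruhat–Geroch 1969, p. 334.
[cite: ChoquetBruhatGeroch1969CMP, Thm. 3, proof (p. 334)] -/
theorem DataEmbedding.isIsometricTo_iff_embedsInto_and_embedsInto {𝒮₁ 𝒮₂ : DataEmbedding D} :
    𝒮₁.IsIsometricTo 𝒮₂ ↔ 𝒮₁.EmbedsInto 𝒮₂ ∧ 𝒮₂.EmbedsInto 𝒮₁ :=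
  ⟨fun h ↦ ⟨h.embedsInto, h.symm.embedsInto⟩,
    fun h ↦ DataEmbedding.isIsometricTo_of_embedsInto' h.1 h.2⟩

/-- Any two maximal vacuum Cauchy developments of the same data are isometric
(`VacuumCauchyDevelopment.isIsometricTo_of_isMaximal'`). Choquet-Bruhat–Geroch 1969, Thm. 3.
[cite: ChoquetBruhatGeroch1969CMP, Thm. 3 (pp. 332–334)] -/
theorem VacuumCauchyDevelopment.isIsometricTo_of_isMaximal_isMaximal
    {𝒟₁ 𝒟₂ : VacuumCauchyDevelopment D} (h₁ : 𝒟₁.IsMaximal) (h₂ : 𝒟₂.IsMaximal) :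
    𝒟₁.toCauchyDevelopment.IsIsometricTo 𝒟₂.toCauchyDevelopment :=
  VacuumCauchyDevelopment.isIsometricTo_of_isMaximal' h₁ h₂

/-- **Given one maximal vacuum Cauchy development, another vacuum Cauchy development of the same
data is maximal iff it is isometric to it** (`→`: uniqueness of the MGHD; `←`: every development
embeds into `𝒟₁`, hence into `𝒟₂` through the isometry). Choquet-Bruhat–Geroch 1969, Thm. 3 and
p. 334 ("we may therefore always refer to such maximal developments").
[cite: ChoquetBruhatGeroch1969CMP, Thm. 3 (pp. 332–334)] -/
theorem VacuumCauchyDevelopment.IsMaximal.isMaximal_iff_isIsometricTo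
    {𝒟₁ 𝒟₂ : VacuumCauchyDevelopment D} (h₁ : 𝒟₁.IsMaximal) :
    𝒟₂.IsMaximal ↔ 𝒟₁.toCauchyDevelopment.IsIsometricTo 𝒟₂.toCauchyDevelopment :=
  ⟨fun h₂ ↦ VacuumCauchyDevelopment.isIsometricTo_of_isMaximal' h₁ h₂,
    fun h 𝒟 ↦ (h₁ 𝒟).trans (CauchyDevelopment.IsIsometricTo.embedsInto h)⟩

/-- **Existence and uniqueness of the MGHD, packaged**: under the named fact
`choquetBruhat_geroch_exists_mghd_cauchy` (existence, Choquet-Bruhat–Geroch 1969, Thm. 3), every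
smooth solution of the vacuum constraints on a connected Hausdorff second countable `3`-manifold
has a maximal vacuum Cauchy development, and any maximal one is isometric to it (uniqueness,
`mghd_unique_cauchy`, unconditional). [cite: ChoquetBruhatGeroch1969CMP, Thm. 3 (p. 332)] -/
theorem choquetBruhat_geroch_exists_mghd_cauchy.existsUnique_upTo_isIsometricTo
    (h : choquetBruhat_geroch_exists_mghd_cauchy) (X : Type) [TopologicalSpace X]
    [ChartedSpace (EuclideanSpace ℝ (Fin 3)) X] [IsManifold (𝓡 3) ∞ X] [T2Space X]
    [SecondCountableTopology X] [ConnectedSpace X] (D : InitialDataSet (𝓡 3) X)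
    [D.metric.HasLeviCivita] (hD : D.IsVacuumConstraintSolution) :
    ∃ 𝒟 : VacuumCauchyDevelopment D, 𝒟.IsMaximal ∧
      ∀ 𝒟' : VacuumCauchyDevelopment D, 𝒟'.IsMaximal →
        𝒟.toCauchyDevelopment.IsIsometricTo 𝒟'.toCauchyDevelopment := by
  obtain ⟨𝒟, h𝒟⟩ := h X D hD
  exact ⟨𝒟, h𝒟, fun 𝒟' h' ↦ mghd_unique_cauchy 𝒟 𝒟' h𝒟 h'⟩

end Restored

end Literature.Geometry.Lorentzian

end
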